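import Summits.HodgeConjecture.HodgeConjecture.Theorems.Ring2ClassTargetsRowsSixSeven
import Summits.HodgeConjecture.HodgeConjecture.Theorems.Ring2AtlasSixfolds
import Literature.AlgebraicGeometry.Motives.AbelianVarietyProductDimProofs
import HarnessLib

/-!
# Ring 2 · kernel class targets — rows `6`, `7` AGAINST THE TYPED ATLAS-2 CELLS (by name)

HONEST FRAMING: research route conditional on HC_CM; not a corollary; Q11.4-sentence-2 already refuted in dim ≥ 3.

Cell `pub-hodge-ring2`, seat `pub-hodge-ring2-typer1` (intermediate-class-target axis; cell lead). Companion of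
`Ring2ClassTargetsRowsSixSeven` (rows `6`, `7` reduce EXACTLY to the Weil classes of Weil-type sixfolds off a
granted class `𝒞`, modulo the codimension census X2 / X1 demanded only OFF `𝒞` and the floor `HCUpToDim 5`) and
of atlas-2's `Ring2AtlasSixfolds` (the typed open cells of rows `6`, `7`). This file only JOINS the two by name:

* §A1 — the four purely six-dimensional atlas-2 cells sit under row `6` (`HCAtDim 6 →` cell): the simple
  quaternion sixfolds, the sextic-CM-field Weil sixfolds, the K3-PARTNER products `Y × Z` (`Y` a quartic-field
  type-IV fourfold, `Z` a CM surface — the motiv product cell `ProdCMCell IsQuarticFieldTypeIVFourfold (dim = 2)`,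
  reduced to strict products by `Ring2.Motiv.hodgeConjectureFor_of_prodCMCell_of_forall_prod` and placed in
  dimension `6 = 4 + 2` by `AbelianVariety.dim_prod`), and the unitary threefold pairs `Y × Y'` (`3 + 3`). The
  two POWER cells (`E^n ×` unitary five- or sixfold) range over all dimensions `≥ 6` and stay under `HC_AV` only
  (atlas-2's `…_of_hodgeAbelianVarieties`). The converse cover (cells + a classification census ⟹ row `6`) is the
  OPEN content of RING2-MAP L3.14 (b) and is NOT asserted here.
* §A2 — the `HC_CM`-plus-one-granted-cell reduction of `Ring2ClassTargetsRowsSixSeven`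
  (`hcUpToDim_seven_iff_weilSixfoldsOff_of_hcCM_of_hcOnClass`) INSTANTIATED at `𝒦 :=` the K3-partner cell, i.e.
  with the hypothesis `Ring2.Atlas.HodgeQuarticTypeIVFourfoldTimesCMSurface` BY NAME: granted `HC_CM` (the binder
  `Theses.RankFourFaces.CMAbelianHodge`, item stmt-HodgeConjecture-3052, by name — never a fact) and that cell,
  rows `≤ 7` are EXACTLY the Weil classes on Weil-type sixfolds outside `CM ∪ (Y × Z)`, modulo the census off
  `CM ∪ (Y × Z)` and the floor. WHY THIS INSTANCE: the census hypothesis X2 (`CodimTwoFromLowerDim`, item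
  stmt-HodgeConjecture-18721) has recorded counter-evidence on CM products (absorbed by `HC_CM`) AND on the non-CM
  K3-partner row (atlas-2: the graph of `T(Z) ≅ ∧²_E H¹(Y)` is an exceptional codimension-2 Hodge class not coming
  from divisors or lower dimension; `Ring2.Atlas.QuarticTypeIVFourfoldCMSurfaceSpanFailure`, EVIDENCE, unproved),
  so the honest reading of RING2-MAP (c7) grants both classes and demands the census only off them.
* §A3 — audit: everything HC-shaped here follows from `HodgeConjecture` (on-path); the census hypotheses are
  never asserted.

No new definitions. `HC_AV` = `Theses.PadicSemiregularLift.HodgeAbelianVarieties` (stmt-HodgeConjecture-1333).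

References (bib keys): MoonenZarhin1999LowDim (Thm. 0.1, §5; arXiv:math/9901113), vanGeemen1994HodgeAV (§3.7),
GortzWedhorn2020 (Lemma 6.26), Lombardo2016 (Lemma 3.4, Remark 4.6), Markman2025SecantWeil = arXiv:2502.03415
(Thm. 1.5.1; UNREFEREED), Milne1999 (§7 (H)), Deligne1982HodgeCycles (§5), Deligne2000 (§1).
-/

set_option linter.dupNamespace false

noncomputable section

open CategoryTheory
open Literature.AlgebraicGeometry Literature.AlgebraicGeometry.Motives
open Literature.AlgebraicGeometry.HodgeTheory
open Literature.AlgebraicGeometry.Milne1999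
open Literature.AlgebraicTopology.SingularHomology
open Literature.Barriers.HodgeConjecture

namespace Summit.HodgeConjecture.HodgeConjecture.Ring2.ClassTargets

open Ring2.Atlas Ring2.Motiv

/-! ## §A1 The six-dimensional atlas-2 cells sit under row `6` -/

/-- **Row `6` ⟹ the K3-partner cell** `HC(Y × Z)` (`Y` a quartic-field type-IV fourfold, `Z` a CM surface; the cell
is isogeny-closed, so one first passes to the strict product by van Geemen's Lemma 3.7 as packaged in
`Ring2.Motiv.hodgeConjectureFor_of_prodCMCell_of_forall_prod`, then `dim (Y × Z) = 4 + 2 = 6`).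
[cite: vanGeemen1994HodgeAV, §3.7 Lemma 3.7] [cite: GortzWedhorn2020, Lemma 6.26] [cite: MoonenZarhin1999LowDim, §5] -/
theorem hodgeQuarticTypeIVFourfoldTimesCMSurface_of_hcAtDim_six (h : HCAtDim 6) :
    HodgeQuarticTypeIVFourfoldTimesCMSurface :=
  fun _ hX ↦ hodgeConjectureFor_of_prodCMCell_of_forall_prod
    (fun A C hA _ hC ↦ h (A.prod C) (show (A.prod C).dim = 6 by rw [AbelianVariety.dim_prod, hA.1, hC])) hX

/-- Rows `≤ 7` ⟹ the K3-partner cell. [cite: MoonenZarhin1999LowDim, §5] -/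
theorem hodgeQuarticTypeIVFourfoldTimesCMSurface_of_hcUpToDim_seven (h : HCUpToDim 7) :
    HodgeQuarticTypeIVFourfoldTimesCMSurface :=
  hodgeQuarticTypeIVFourfoldTimesCMSurface_of_hcAtDim_six
    (hcAtDim_of_hcUpToDim (hcUpToDim_mono (by norm_num) h))

/-- **Row `6` ⟹ the unitary-threefold-pair cell** `HC(Y × Y')` (`dim (Y × Y') = 3 + 3 = 6`).
[cite: GortzWedhorn2020, Lemma 6.26] [cite: MoonenZarhin1999LowDim, §5] -/
theorem hodgeUnitaryThreefoldPair_of_hcAtDim_six (h : HCAtDim 6) : HodgeUnitaryThreefoldPair :=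
  fun Y Y' _ _ _ _ hY hY' _ _ _ _ _ ↦
    h (Y.prod Y') (show (Y.prod Y').dim = 6 by rw [AbelianVariety.dim_prod, hY, hY'])

/-- Rows `≤ 7` ⟹ the unitary-threefold-pair cell. [cite: MoonenZarhin1999LowDim, §5] -/
theorem hodgeUnitaryThreefoldPair_of_hcUpToDim_seven (h : HCUpToDim 7) : HodgeUnitaryThreefoldPair :=
  hodgeUnitaryThreefoldPair_of_hcAtDim_six (hcAtDim_of_hcUpToDim (hcUpToDim_mono (by norm_num) h))

/-- **Row `6` ⟹ its four typed atlas-2 cells** (the trivial direction of the cover RING2-MAP L3.14 (b); the two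
power cells of `Ring2AtlasSixfolds` range over all dimensions `≥ 6` and are cases of `HC_AV` only). The converse —
these cells plus Moonen–Zarhin-type classification facts give row `6` — is the OPEN cover claim, not asserted.
[cite: MoonenZarhin1999LowDim, Thm. 0.1 and §5] [cite: Markman2025SecantWeil, Thm. 1.5.1] -/
theorem atlasTwoSixfoldCells_of_hcAtDim_six (h : HCAtDim 6) :
    HodgeQuaternionSixfold ∧ HodgeSexticFieldWeilSixfold ∧ HodgeQuarticTypeIVFourfoldTimesCMSurface ∧
      HodgeUnitaryThreefoldPair :=
  ⟨hodgeQuaternionSixfold_of_hcAtDim_six h, hodgeSexticFieldWeilSixfold_of_hcAtDim_six h,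
    hodgeQuarticTypeIVFourfoldTimesCMSurface_of_hcAtDim_six h, hodgeUnitaryThreefoldPair_of_hcAtDim_six h⟩

/-- Rows `≤ 7` ⟹ the four typed six-dimensional atlas-2 cells. [cite: MoonenZarhin1999LowDim, §5] -/
theorem atlasTwoSixfoldCells_of_hcUpToDim_seven (h : HCUpToDim 7) :
    HodgeQuaternionSixfold ∧ HodgeSexticFieldWeilSixfold ∧ HodgeQuarticTypeIVFourfoldTimesCMSurface ∧
      HodgeUnitaryThreefoldPair :=
  atlasTwoSixfoldCells_of_hcAtDim_six (hcAtDim_of_hcUpToDim (hcUpToDim_mono (by norm_num) h))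

/-! ## §A2 `HC_CM` + the K3-partner cell: rows `≤ 7` ↔ Weil sixfolds off `CM ∪ (Y × Z)`, modulo the census off it -/

/-- **Rows `≤ 7`, granted `HC_CM` AND the K3-partner cell (both BY NAME), are EXACTLY the Weil classes on the
Weil-type sixfolds lying outside `CM ∪ {Y × Z}`** — modulo the codimension census X2 / X1 demanded only for six- and
sevenfolds that are neither of CM type nor in the K3-partner cell, and the floor `HCUpToDim 5`. This is
`hcUpToDim_seven_iff_weilSixfoldsOff_of_hcCM_of_hcOnClass` at `𝒦 := ProdCMCell IsQuarticFieldTypeIVFourfold (dim = 2)`,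
whose `HCOnClass 𝒦` IS `Ring2.Atlas.HodgeQuarticTypeIVFourfoldTimesCMSurface`. The two granted classes are exactly
the two loci where the census hypothesis X2 (`Theses.SevenfoldWeilCensus.CodimTwoFromLowerDim`) has recorded
counter-evidence (CM products: Pohlmann / `ζ₂₄`; non-CM: atlas-2's K3 partner, `QuarticTypeIVFourfoldCMSurfaceSpanFailure`,
unproved EVIDENCE) — so this is the current honest form of RING2-MAP (c7) for rows `6`, `7`. `HC_CM` enters only
through `hcOnClass_cmType_of_hcCM`; nothing here is a corollary of `HC_CM`.
[cite: Milne1999, §7 (H)] [cite: Deligne1982HodgeCycles, §5] [cite: MoonenZarhin1999LowDim, §5; arXiv:math/9901113]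
[cite: Lombardo2016, Remark 4.6] [cite: Markman2025SecantWeil, Thm. 1.5.1] -/
theorem hcUpToDim_seven_iff_weilSixfoldsOff_of_hcCM_of_k3Partner (hCM : Theses.RankFourFaces.CMAbelianHodge)
    (hK : HodgeQuarticTypeIVFourfoldTimesCMSurface)
    (h₃ : ∀ A : AbelianVariety ℂ, A.dim = 6 ∨ A.dim = 7 →
      ¬ (IsOfCMType A ∨ ProdCMCell IsQuarticFieldTypeIVFourfold (fun Z ↦ Z.dim = 2) A) →
      ∀ c : complexBetti A.X (2 * 2), IsRationalClass c → IsOfHodgeType A.dim A.X (2 * 2) 2 2 c →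
        c ∈ divisorClassesSpan A.X A.dim 2 ⊔ Submodule.span ℂ {w' : complexBetti A.X (2 * 2) |
          ∃ (C : AbelianVariety ℂ) (g : A.X ⟶ C.X) (w : complexBetti C.X (2 * 2)), C.dim < A.dim ∧
            IsRationalClass w ∧ IsOfHodgeType C.dim C.X (2 * 2) 2 2 w ∧ w' = complexBetti.map g (2 * 2) w})
    (h₂ : ∀ A : AbelianVariety ℂ, A.dim = 6 ∨ A.dim = 7 →
      ¬ (IsOfCMType A ∨ ProdCMCell IsQuarticFieldTypeIVFourfold (fun Z ↦ Z.dim = 2) A) →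
      ∀ c : complexBetti A.X (2 * 3), IsRationalClass c → IsOfHodgeType A.dim A.X (2 * 3) 3 3 c →
        c ∈ divisorClassesSpan A.X A.dim 3 ⊔ Submodule.span ℂ {w' : complexBetti A.X (2 * 3) |
            ∃ (a : complexBetti A.X (2 * 2)) (b : complexBetti A.X (2 * 1)),
              IsRationalClass a ∧ IsOfHodgeType A.dim A.X (2 * 2) 2 2 a ∧ IsRationalClass b ∧
              IsOfHodgeType A.dim A.X (2 * 1) 1 1 b ∧ w' = cupProduct (two_mul_add_two_mul 2 1) a b} ⊔
          Submodule.span ℂ {w' : complexBetti A.X (2 * 3) |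
            ∃ (C : AbelianVariety ℂ) (g : A.X ⟶ C.X) (w : complexBetti C.X (2 * 3)), C.dim < A.dim ∧
              IsRationalClass w ∧ IsOfHodgeType C.dim C.X (2 * 3) 3 3 w ∧ w' = complexBetti.map g (2 * 3) w} ⊔
          Submodule.span ℂ {w' : complexBetti A.X (2 * 3) |
            ∃ (B : AbelianVariety ℂ) (g : A.X ⟶ B.X) (d : ℕ) (ψ : B ⟶ B) (w : complexBetti B.X (2 * 3)),
              B.dim = 6 ∧ 0 < d ∧ ψ ≫ ψ = -(d • 𝟙 B) ∧ IsRationalClass w ∧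
              IsOfHodgeType B.dim B.X (2 * 3) 3 3 w ∧ w ∈ weilClassesOf B ψ 3 d ∧
              w' = complexBetti.map g (2 * 3) w})
    (h₅ : HCUpToDim 5) :
    HCUpToDim 7 ↔
      ∀ (d : ℕ), 0 < d → ∀ (B : AbelianVariety ℂ) (ψ : B ⟶ B), B.dim = 6 → ψ ≫ ψ = -(d • 𝟙 B) →
        ¬ (IsOfCMType B ∨ ProdCMCell IsQuarticFieldTypeIVFourfold (fun Z ↦ Z.dim = 2) B) →
        ∀ w : complexBetti B.X (2 * 3), IsRationalClass w →
          IsOfHodgeType B.dim B.X (2 * 3) 3 3 w → w ∈ weilClassesOf B ψ 3 d → w ∈ algebraicClasses B.X 3 :=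
  hcUpToDim_seven_iff_weilSixfoldsOff_of_hcCM_of_hcOnClass hCM hK h₃ h₂ h₅

/-- The unconditional half of §A2: rows `≤ 7` give the Weil classes of every Weil-type sixfold off any class — in
particular off `CM ∪ (Y × Z)` — with no census and no `HC_CM` (`weilSixfoldsOff_of_weilSixfolds`). Recorded so that
the `↔` above is read correctly: all the content is in `←`. [cite: Deligne2000, §1] [cite: Markman2025SecantWeil, Thm. 1.5.1] -/
theorem weilSixfoldsOff_k3Partner_of_hcUpToDim_seven (h : HCUpToDim 7) :
    ∀ (d : ℕ), 0 < d → ∀ (B : AbelianVariety ℂ) (ψ : B ⟶ B), B.dim = 6 → ψ ≫ ψ = -(d • 𝟙 B) →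
      ¬ (IsOfCMType B ∨ ProdCMCell IsQuarticFieldTypeIVFourfold (fun Z ↦ Z.dim = 2) B) →
      ∀ w : complexBetti B.X (2 * 3), IsRationalClass w →
        IsOfHodgeType B.dim B.X (2 * 3) 3 3 w → w ∈ weilClassesOf B ψ 3 d → w ∈ algebraicClasses B.X 3 :=
  weilSixfoldsOff_of_weilSixfolds _ (weilSixfolds_of_hcUpToDim_seven h)

/-! ## §A3 Audit: on-path -/

/-- Audit: the K3-partner cell, the unitary-threefold-pair cell, the four-cell conjunction and the Weil sixfolds
off `CM ∪ (Y × Z)` all follow from `HodgeConjecture`; the census hypotheses of §A2 are NOT consequences of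
`HodgeConjecture` and are never asserted. [cite: Deligne2000, §1] -/
theorem rowsSixSevenAtlas_of_hodgeConjecture (h : _root_.HodgeConjecture) :
    (HodgeQuaternionSixfold ∧ HodgeSexticFieldWeilSixfold ∧ HodgeQuarticTypeIVFourfoldTimesCMSurface ∧
      HodgeUnitaryThreefoldPair) ∧
    ∀ (d : ℕ), 0 < d → ∀ (B : AbelianVariety ℂ) (ψ : B ⟶ B), B.dim = 6 → ψ ≫ ψ = -(d • 𝟙 B) →
      ¬ (IsOfCMType B ∨ ProdCMCell IsQuarticFieldTypeIVFourfold (fun Z ↦ Z.dim = 2) B) →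
      ∀ w : complexBetti B.X (2 * 3), IsRationalClass w →
        IsOfHodgeType B.dim B.X (2 * 3) 3 3 w → w ∈ weilClassesOf B ψ 3 d → w ∈ algebraicClasses B.X 3 :=
  ⟨atlasTwoSixfoldCells_of_hcUpToDim_seven (hcOnClass_of_hodgeConjecture _ h),
    weilSixfoldsOff_k3Partner_of_hcUpToDim_seven (hcOnClass_of_hodgeConjecture _ h)⟩

end Summit.HodgeConjecture.HodgeConjecture.Ring2.ClassTargets

end
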